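import Literature.Claims.NS.Xu2024

/-!
# C10 `Xu2024` — kernel refutation of the first half of display (3.70) «r_ε → ∞ as ε → 0⁺» (p.19–20)

Text of record: Xu, arXiv:2401.17147 **v18**, typed skeleton `Literature.Claims.NS.Xu2024` (typist-10,
p465831 + rev 2 p466982, commit d7890dd70b44; bib `Xu2024NSLinfty`).  In the proof of Theorem 1.1, §3,
case (3.66), the paper sets `h(s) = f(s)/(s^{1−ε}(s−2j)^ε)` on `(2j,∞)`, lets `r_ε` be the largest solution
of (3.69) `h(s) = (1+ε) ln‖u‖_∞` («Obviously, the largest solution exists») and asserts (3.70)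
«`r_ε → ∞` as `ε → 0⁺`», which feeds (3.72)–(3.74).  The skeleton types this, at the by-declaration grain of
cell rule F15 / TYPING-HYGIENE 13, as `Step_12 := RootDivergence_asPrinted` over the paper's standing premises
on `f` (`Premises f L q j`: `L = ln‖u‖_∞ > 0`, `0 < q < j`, `f` differentiable and convex on `[2q,∞)`,
(3.53) `f > 0`, (3.54) `f(r)/r < f′(r)`, (3.68) `f(s)/s → L`).

Mechanism (`root_lt_four_mul`, `rootBound_four_mul`): the premises force `f(s)/s < L` on `[2q,∞)`
(`div_lt_of_premises`: `s ↦ f(s)/s` is strictly increasing by (3.54) and tends to `L`), and then EVERY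
root `s > 2j` of (3.69) satisfies `s < 4j`, uniformly in `ε ∈ (0,1]` — because for `s ≥ 4j`,
`s^{1−ε}(s−2j)^ε ≥ s·2^{−ε} ≥ s/(1+ε)` (Bernoulli), so `h(s) ≤ (1+ε) f(s)/s < (1+ε)L`.  Hence no selection
of largest roots can tend to `∞` (`not_tendsto_of_premises`), and the premises are consistent: the model
`f(s) = s − 1` (`L = 1`, `q = 1`, `j = 2`; `premises_fm`) has, for every `ε ∈ (0,1)`, a largest root
`r_ε ∈ [4 + (3/10)^{1/ε}, 8]` of (3.69) (IVT on `hfun`, compactness of the root set; `rE_isLargestRoot`,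
`rE_lt`).

* `not_Step_12 : ¬ Literature.Claims.NS.Xu2024.Step_12` (= `not_RootDivergence_asPrinted`; (3.70) first
  half, print p.19 statement / p.20 proof);
* `witness370` — the explicit countermodel package (ref-4's RETYPE shape `Witness370`, inlined as the theorem's statement).

The solution-level instance `Step_12_NS` (the same display read about the paper's `f = f_log` of an actual
bounded classical solution) is not decided here (no such solution with the (3.66) alternative is constructible
in the tree); `step_12_NS_of_steps` shows it is what `Step_3 ∧ Step_12` would give.  Closed terms over
Mathlib's `ℝ` (`Real.rpow`, `sSup`, IVT); axioms `propext`, `Classical.choice`, `Quot.sound`.  Refuter: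
ns-claims-refuter-5 (scaffold `XuScaffold.lean` 2026-08-26T18:46Z, sha16 502c00f68c48c3ae); filed under interim
convention (b) by the paired salvage prover.

WHAT THIS IS NOT: not a claim about NS regularity or blow-up; not a claim about any author beyond the typed
locator.
-/

-- The summit's canonical theorem namespace repeats the summit name (single-conjunct summit).
set_option linter.dupNamespace false

noncomputable section

open Set Filter Topology
open Literature.Claims.NS.Xu2024

namespace Summit.NavierStokesRegularity.NavierStokesRegularity.Theorems.Xu2024


/-- Bernoulli: `2^ε ≤ 1 + ε` for `ε ∈ [0,1]`. [folklore] -/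
theorem two_rpow_le_one_add {ε : ℝ} (h0 : 0 ≤ ε) (h1 : ε ≤ 1) : (2 : ℝ) ^ ε ≤ 1 + ε := by
  have h := rpow_one_add_le_one_add_mul_self (s := 1) (by norm_num) h0 h1
  norm_num at h
  exact h

/-- Denominator bound: for `s ≥ 4j > 0`, `ε ∈ [0,1]`: `s/(1+ε) ≤ s^{1−ε}(s−2j)^ε`. [cite: Xu2024NSLinfty, (3.69)–(3.70) p.19–20] -/
theorem denom_ge {j ε s : ℝ} (hj : 0 < j) (h0 : 0 ≤ ε) (h1 : ε ≤ 1) (hs : 4 * j ≤ s) :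
    s / (1 + ε) ≤ s ^ (1 - ε) * (s - 2 * j) ^ ε := by
  have hs0 : 0 < s := by linarith
  have hhalf : s / 2 ≤ s - 2 * j := by linarith
  have h2 : (s / 2) ^ ε ≤ (s - 2 * j) ^ ε := Real.rpow_le_rpow (by positivity) hhalf h0
  have h3 : s ^ (1 - ε) * (s / 2) ^ ε = s / 2 ^ ε := by
    rw [Real.div_rpow hs0.le (by norm_num : (0:ℝ) ≤ 2), ← mul_div_assoc, ← Real.rpow_add hs0]
    norm_num
  have h4 : s / (1 + ε) ≤ s / 2 ^ ε :=
    div_le_div_of_nonneg_left hs0.le (by positivity) (two_rpow_le_one_add h0 h1)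
  calc s / (1 + ε) ≤ s / 2 ^ ε := h4
    _ = s ^ (1 - ε) * (s / 2) ^ ε := h3.symm
    _ ≤ s ^ (1 - ε) * (s - 2 * j) ^ ε :=
        mul_le_mul_of_nonneg_left h2 (Real.rpow_nonneg hs0.le _)

/-- Every root `s > 2j` of (3.69) with `f(s)/s < L` satisfies `s < 4j`, uniformly in `ε ∈ (0,1]`. [cite: Xu2024NSLinfty, (3.69)–(3.70) p.19–20] -/
theorem root_lt_four_mul (f : ℝ → ℝ) {j L ε s : ℝ} (hj : 0 < j) (hL : 0 < L) (h0 : 0 < ε)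
    (h1 : ε ≤ 1) (hfs : f s / s < L) (hroot : hfun f j ε s = (1 + ε) * L) :
    s < 4 * j := by
  by_contra hcon
  push Not at hcon
  have hs0 : 0 < s := by linarith
  have hD : s / (1 + ε) ≤ s ^ (1 - ε) * (s - 2 * j) ^ ε := denom_ge hj h0.le h1 hcon
  have hDpos : 0 < s ^ (1 - ε) * (s - 2 * j) ^ ε := lt_of_lt_of_le (by positivity) hD
  have hfs' : f s < L * s := by rwa [div_lt_iff₀ hs0] at hfs
  have hf : f s = (1 + ε) * L * (s ^ (1 - ε) * (s - 2 * j) ^ ε) := by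
    unfold hfun at hroot
    rw [div_eq_iff hDpos.ne'] at hroot
    exact hroot
  have hle : L * s ≤ (1 + ε) * L * (s ^ (1 - ε) * (s - 2 * j) ^ ε) := by
    calc L * s = (1 + ε) * L * (s / (1 + ε)) := by field_simp
      _ ≤ (1 + ε) * L * (s ^ (1 - ε) * (s - 2 * j) ^ ε) :=
          mul_le_mul_of_nonneg_left hD (by positivity)
  linarith

/-! ## Stand-in target (ref-4's retype shapes, verbatim) -/




/-- The model family `f(s) = L s + ln m` (ref-4's RETYPE). [cite: Xu2024NSLinfty, (3.69)–(3.70) p.19–20] -/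
def modelF (L m : ℝ) (s : ℝ) : ℝ := L * s + Real.log m

/-! ## The model instance: `L = 1`, `m = e^{-1}`, `q = 1`, `j = 2`, so `f(s) = s - 1`. -/

/-- The model function `f(s) = s − 1` (`L = 1`, `m = e^{−1}`). [cite: Xu2024NSLinfty, (3.69)–(3.70) p.19–20] -/
def fm : ℝ → ℝ := modelF 1 (Real.exp (-1))

/-- `fm = (s ↦ s − 1)`. [folklore] -/
theorem fm_eq : fm = fun s => s - 1 := by
  funext s; simp [fm, modelF]; ring

/-- `fm s = s − 1`. [folklore] -/
theorem fm_apply (s : ℝ) : fm s = s - 1 := by rw [fm_eq]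

/-- The model satisfies the paper's standing premises with `L = 1`, `q = 1`, `j = 2` ((3.53), (3.54), (3.68), convexity). [cite: Xu2024NSLinfty, (3.53)–(3.54) p.16; (3.67)–(3.68) p.19] -/
theorem premises_fm : Premises fm 1 1 2 where
  L_pos := one_pos
  q_pos := one_pos
  q_lt_j := by norm_num
  diff := fun r _ => by rw [fm_eq]; fun_prop
  convex := by
    refine ⟨convex_Ici _, ?_⟩
    intro x _ y _ a b _ _ hab
    have hb : b = 1 - a := by linarith
    subst hb
    simp only [fm_apply, smul_eq_mul]
    exact le_of_eq (by ring)
  pos := fun s hs => by rw [fm_apply]; linarith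
  incr := fun r hr => by
    have hd : HasDerivAt fm 1 r := by
      rw [fm_eq]; exact (hasDerivAt_id r).sub_const 1
    rw [hd.deriv, fm_apply, div_lt_one (by linarith)]
    linarith
  lim := by
    have h : Tendsto (fun s : ℝ => 1 - s⁻¹) atTop (𝓝 (1 - 0)) :=
      tendsto_const_nhds.sub tendsto_inv_atTop_zero
    rw [sub_zero] at h
    refine h.congr' ?_
    filter_upwards [eventually_ne_atTop (0:ℝ)] with s hs
    rw [fm_apply]; field_simp

/-- `f(s)/s < L = 1` for the model, every `s > 0`. [folklore] -/
theorem fm_div_lt {s : ℝ} (hs : 0 < s) : fm s / s < 1 := by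
  rw [fm_apply, div_lt_one hs]; linarith

/-- Left end of the IVT interval: `a_ε = 2j + (3/10)^{1/ε}`. [cite: Xu2024NSLinfty, (3.69)–(3.70) p.19–20] -/
def aE (ε : ℝ) : ℝ := 4 + (3 / 10 : ℝ) ^ (1 / ε)

/-- The root set of (3.69) inside `[a_ε, 4j]`. [cite: Xu2024NSLinfty, (3.69)–(3.70) p.19–20] -/
def rootSet (ε : ℝ) : Set ℝ := Icc (aE ε) 8 ∩ (hfun fm 2 ε) ⁻¹' {(1 + ε) * 1}

/-- The constructed largest root `r_ε = sup` of the root set. [cite: Xu2024NSLinfty, (3.69)–(3.70) p.19–20] -/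
def rE (ε : ℝ) : ℝ := sSup (rootSet ε)

/-- `(3/10)^{1/ε} > 0`. [folklore] -/
theorem delta_pos (ε : ℝ) : 0 < (3 / 10 : ℝ) ^ (1 / ε) := Real.rpow_pos_of_pos (by norm_num) _

/-- `a_ε > 2j = 4`. [folklore] -/
theorem four_lt_aE (ε : ℝ) : 4 < aE ε := by
  have := delta_pos ε; unfold aE; linarith

/-- `a_ε ≤ 5` for `ε > 0`. [folklore] -/
theorem aE_le_five {ε : ℝ} (h0 : 0 < ε) : aE ε ≤ 5 := by
  have : (3 / 10 : ℝ) ^ (1 / ε) ≤ 1 := Real.rpow_le_one (by norm_num) (by norm_num) (by positivity)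
  unfold aE; linarith

/-- `h` is continuous on `[a,b]` for `a > 2j`. [cite: Xu2024NSLinfty, (3.69)–(3.70) p.19–20] -/
theorem hfun_continuousOn {ε a b : ℝ} (h0 : 0 < ε) (ha : 4 < a) :
    ContinuousOn (hfun fm 2 ε) (Icc a b) := by
  have hpos : ∀ x ∈ Icc a b, (0:ℝ) < x := fun x hx => by linarith [hx.1]
  have hpos' : ∀ x ∈ Icc a b, (0:ℝ) < x - 2 * 2 := fun x hx => by linarith [hx.1]
  unfold hfun
  apply ContinuousOn.div
  · rw [fm_eq]; fun_prop
  · apply ContinuousOn.mul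
    · exact continuousOn_id.rpow_const fun x hx => Or.inl (hpos x hx).ne'
    · exact (continuousOn_id.sub continuousOn_const).rpow_const fun x hx => Or.inr h0.le
  · intro x hx
    exact (mul_pos (Real.rpow_pos_of_pos (hpos x hx) _) (Real.rpow_pos_of_pos (hpos' x hx) _)).ne'

/-- `h(a_ε) ≥ (1+ε)L` for `ε ∈ (0,1)`. [cite: Xu2024NSLinfty, (3.69)–(3.70) p.19–20] -/
theorem hfun_aE_ge {ε : ℝ} (h0 : 0 < ε) (h1 : ε < 1) : (1 + ε) * 1 ≤ hfun fm 2 ε (aE ε) := by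
  have ha4 := four_lt_aE ε
  have ha5 := aE_le_five h0
  set a := aE ε with ha_def
  have hδ : a - 2 * 2 = (3 / 10 : ℝ) ^ (1 / ε) := by rw [ha_def]; unfold aE; ring
  have hδε : (a - 2 * 2) ^ ε = 3 / 10 := by
    rw [hδ, ← Real.rpow_mul (by norm_num : (0:ℝ) ≤ 3 / 10), one_div, inv_mul_cancel₀ h0.ne',
      Real.rpow_one]
  have hapow : a ^ (1 - ε) ≤ 5 := by
    calc a ^ (1 - ε) ≤ a ^ (1:ℝ) := Real.rpow_le_rpow_of_exponent_le (by linarith) (by linarith)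
      _ = a := Real.rpow_one a
      _ ≤ 5 := ha5
  have hPpos : 0 < a ^ (1 - ε) := Real.rpow_pos_of_pos (by linarith) _
  unfold hfun
  rw [fm_apply, hδε, le_div_iff₀ (by positivity)]
  generalize a ^ (1 - ε) = P at hapow hPpos ⊢
  have h2 : (1 + ε) * 1 * (P * (3 / 10)) ≤ 2 * (P * (3 / 10)) :=
    mul_le_mul_of_nonneg_right (by linarith) (by positivity)
  linarith

/-- `h(4j) ≤ (1+ε)L`. [cite: Xu2024NSLinfty, (3.69)–(3.70) p.19–20] -/
theorem hfun_eight_le {ε : ℝ} (h0 : 0 < ε) (h1 : ε ≤ 1) : hfun fm 2 ε 8 ≤ (1 + ε) * 1 := by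
  have hD : (8:ℝ) / (1 + ε) ≤ 8 ^ (1 - ε) * (8 - 2 * 2) ^ ε :=
    denom_ge (j := 2) (by norm_num) h0.le h1 (by norm_num)
  have hDpos : (0:ℝ) < 8 ^ (1 - ε) * (8 - 2 * 2) ^ ε := lt_of_lt_of_le (by positivity) hD
  unfold hfun
  rw [fm_apply, div_le_iff₀ hDpos]
  generalize (8:ℝ) ^ (1 - ε) * (8 - 2 * 2) ^ ε = D at hD hDpos ⊢
  have h8 : (8:ℝ) ≤ D * (1 + ε) := (div_le_iff₀ (by positivity)).mp hD
  linarith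

/-- (3.69) has a root in `[a_ε, 4j]` (IVT). [cite: Xu2024NSLinfty, (3.69)–(3.70) p.19–20] -/
theorem rootSet_nonempty {ε : ℝ} (h0 : 0 < ε) (h1 : ε < 1) : (rootSet ε).Nonempty := by
  have ha4 := four_lt_aE ε
  have hab : aE ε ≤ 8 := by linarith [aE_le_five h0]
  have hivt := intermediate_value_Icc' hab (hfun_continuousOn (b := 8) h0 ha4)
  have hmem : (1 + ε) * 1 ∈ Icc (hfun fm 2 ε 8) (hfun fm 2 ε (aE ε)) :=
    ⟨hfun_eight_le h0 h1.le, hfun_aE_ge h0 h1⟩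
  obtain ⟨c, hc, hcv⟩ := hivt hmem
  exact ⟨c, hc, hcv⟩

/-- The root set is compact. [folklore] -/
theorem rootSet_isCompact {ε : ℝ} (h0 : 0 < ε) : IsCompact (rootSet ε) :=
  IsCompact.of_isClosed_subset isCompact_Icc
    ((hfun_continuousOn (b := 8) h0 (four_lt_aE ε)).preimage_isClosed_of_isClosed isClosed_Icc
      isClosed_singleton) inter_subset_left

/-- `r_ε` is a root. [cite: Xu2024NSLinfty, (3.69)–(3.70) p.19–20] -/
theorem rE_mem {ε : ℝ} (h0 : 0 < ε) (h1 : ε < 1) : rE ε ∈ rootSet ε :=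
  (rootSet_isCompact h0).sSup_mem (rootSet_nonempty h0 h1)

/-- `r_ε` is the LARGEST root of (3.69) on `(2j,∞)`. [cite: Xu2024NSLinfty, (3.69)–(3.70) p.19–20] -/
theorem rE_isLargestRoot {ε : ℝ} (hε : ε ∈ Ioo (0:ℝ) 1) : IsLargestRoot fm 1 2 ε (rE ε) := by
  obtain ⟨h0, h1⟩ := hε
  have hmem := rE_mem h0 h1
  have ha4 := four_lt_aE ε
  refine ⟨by linarith [hmem.1.1], hmem.2, ?_⟩
  intro s hs hroot
  have hs8 : s < 4 * 2 :=
    root_lt_four_mul fm (by norm_num) one_pos h0 h1.le (fm_div_lt (by linarith [hmem.1.1])) hroot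
  have hsmem : s ∈ rootSet ε := ⟨⟨by linarith [hmem.1.1], by linarith⟩, hroot⟩
  have : s ≤ rE ε := le_csSup (rootSet_isCompact h0).bddAbove hsmem
  linarith

/-- `r_ε < 4j`. [cite: Xu2024NSLinfty, (3.69)–(3.70) p.19–20] -/
theorem rE_lt {ε : ℝ} (hε : ε ∈ Ioo (0:ℝ) 1) : rE ε < 4 * 2 := by
  obtain ⟨h0, h1⟩ := hε
  have hmem := rE_mem h0 h1
  have ha4 := four_lt_aE ε
  exact root_lt_four_mul fm (by norm_num) one_pos h0 h1.le (fm_div_lt (by linarith [hmem.1.1]))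
    hmem.2

/-- **The countermodel package holds** (ref-4's RETYPE shape `Witness370`, verbatim, INLINED as the
statement of this theorem — filer's note, salvage-p4: the author's closed `def Witness370 : Prop` was
turned into this theorem's statement so that the gate does not relocate a witness `Prop` into
`Literature/`; nothing else changed): premises-satisfying data (`f = modelF L m`, `0 < m < 1`) whose
largest roots `r_ε` of (3.69) all lie below `4j`. [cite: Xu2024NSLinfty, (3.69)–(3.70) p.19–20] -/
theorem witness370 :
    ∃ (L m q j : ℝ), 0 < m ∧ m < 1 ∧ Premises (modelF L m) L q j ∧
      ∃ rε : ℝ → ℝ, (∀ ε ∈ Ioo (0 : ℝ) 1, IsLargestRoot (modelF L m) L j ε (rε ε)) ∧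
        ∀ ε ∈ Ioo (0 : ℝ) 1, rε ε < 4 * j :=
  ⟨1, Real.exp (-1), 1, 2, Real.exp_pos _, Real.exp_lt_one_iff.mpr (by norm_num), premises_fm,
    rE, fun _ hε => rE_isLargestRoot hε, fun _ hε => rE_lt hε⟩

/-- **(3.70), first half, as printed, is false.** [cite: Xu2024NSLinfty, (3.69)–(3.70) p.19–20] -/
theorem not_RootDivergence_asPrinted : ¬ RootDivergence_asPrinted := by
  intro H
  have hT : Tendsto rE (𝓝[>] 0) atTop :=
    H fm 1 1 2 premises_fm rE fun _ hε => rE_isLargestRoot hε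
  have hev : ∀ᶠ ε in 𝓝[>] (0:ℝ), (4 * 2 : ℝ) < rE ε ∧ ε ∈ Ioo (0:ℝ) 1 :=
    (hT.eventually (eventually_gt_atTop _)).and (Ioo_mem_nhdsGT zero_lt_one)
  obtain ⟨ε, hbig, hε⟩ := hev.exists
  exact absurd (rE_lt hε) (not_lt.mpr hbig.le)

/-! ## Structural version: under the printed premises EVERY root of (3.69) lies below `4j`
(ref-4's `RootBound` in the weaker `4j` form) — the obstruction is not an artefact of the model. -/

/-- Under the premises, `f(s)/s < L` on `[2q,∞)` (`f(s)/s` strictly increasing by (3.54), limit `L` by (3.68)). [cite: Xu2024NSLinfty, (3.54) p.16; (3.68) p.19] -/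
theorem div_lt_of_premises {f : ℝ → ℝ} {L q j : ℝ} (P : Premises f L q j) {s : ℝ}
    (hs : 2 * q ≤ s) : f s / s < L := by
  have hq := P.q_pos
  set g : ℝ → ℝ := fun r => f r / r with hg
  have hderiv : ∀ x, 2 * q ≤ x → HasDerivAt g ((deriv f x * x - f x * 1) / x ^ 2) x := by
    intro x hx
    have hx0 : x ≠ 0 := by intro h; rw [h] at hx; linarith
    exact (P.diff x hx).hasDerivAt.div (hasDerivAt_id x) hx0
  have hcont : ContinuousOn g (Ici (2 * q)) := fun x hx =>
    (hderiv x hx).continuousAt.continuousWithinAt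
  have hmono : StrictMonoOn g (Ici (2 * q)) := by
    apply strictMonoOn_of_deriv_pos (convex_Ici _) hcont
    intro x hx
    rw [interior_Ici] at hx
    have hx' : 2 * q ≤ x := le_of_lt hx
    have hx0 : 0 < x := by linarith
    rw [(hderiv x hx').deriv]
    apply div_pos _ (by positivity)
    have := P.incr x hx'
    rw [div_lt_iff₀ hx0] at this
    linarith
  by_contra hcon
  push Not at hcon
  have h1 : g s < g (s + 1) := hmono hs (show s + 1 ∈ Ici (2 * q) by simp; linarith) (by linarith)
  have h2 : g (s + 1) ≤ L := by
    refine ge_of_tendsto P.lim ?_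
    filter_upwards [eventually_ge_atTop (s + 1)] with r hr
    exact hmono.monotoneOn (show s + 1 ∈ Ici (2 * q) by simp; linarith)
      (show r ∈ Ici (2 * q) by simp; linarith) hr
  have h3 : L ≤ g s := hcon
  linarith

/-- Under the premises every root `r > 2j` of (3.69) lies below `4j`, for every `ε ∈ (0,1]`. [cite: Xu2024NSLinfty, (3.69)–(3.70) p.19–20] -/
theorem rootBound_four_mul {f : ℝ → ℝ} {L q j : ℝ} (P : Premises f L q j) {ε r : ℝ}
    (h0 : 0 < ε) (h1 : ε ≤ 1) (hr : 2 * j < r) (hroot : hfun f j ε r = (1 + ε) * L) :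
    r < 4 * j :=
  root_lt_four_mul f (P.q_pos.trans P.q_lt_j) P.L_pos h0 h1
    (div_lt_of_premises P (by linarith [P.q_lt_j])) hroot

/-- Under the premises NO selection of largest roots tends to `∞` as `ε → 0⁺`. [cite: Xu2024NSLinfty, (3.69)–(3.70) p.19–20] -/
theorem not_tendsto_of_premises {f : ℝ → ℝ} {L q j : ℝ} (P : Premises f L q j) {rε : ℝ → ℝ}
    (hr : ∀ ε ∈ Ioo (0 : ℝ) 1, IsLargestRoot f L j ε (rε ε)) : ¬ Tendsto rε (𝓝[>] 0) atTop := by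
  intro hT
  have hev : ∀ᶠ ε in 𝓝[>] (0:ℝ), 4 * j < rε ε ∧ ε ∈ Ioo (0:ℝ) 1 :=
    (hT.eventually (eventually_gt_atTop _)).and (Ioo_mem_nhdsGT zero_lt_one)
  obtain ⟨ε, hbig, hε⟩ := hev.exists
  obtain ⟨h2j, hroot, -⟩ := hr ε hε
  exact absurd (rootBound_four_mul P hε.1 hε.2.le h2j hroot) (not_lt.mpr hbig.le)


/-- **(3.70), first half, is false as printed**: `Step_12 := RootDivergence_asPrinted` of the skeleton.
[cite: Xu2024NSLinfty, (3.70) p.19–20] -/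
theorem not_Step_12 : ¬ Step_12 := not_RootDivergence_asPrinted

end Summit.NavierStokesRegularity.NavierStokesRegularity.Theorems.Xu2024

end
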